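import Summits.SmoothPoincare4.SmoothPoincare4.Theorems.SullivanDualTargetHelperCtkwOfPrimitive
import Summits.SmoothPoincare4.SmoothPoincare4.Theorems.SullivanDualTargetHelperPrimitiveOnPuncturedBall
import Summits.SmoothPoincare4.SmoothPoincare4.Theorems.SullivanDualTargetHelperPoincarePuncturedChartBall
import Summits.SmoothPoincare4.SmoothPoincare4.Theorems.SullivanDualTargetOfSympcap

/-!
# SmoothPoincare4 / SullivanDual — crux `Target` (stmt-SmoothPoincare4-7823), line `Sketch`:
# closed taming kills witnesses; `Target ⇐ WeakTame`

The entry door of the crux ideas `crofton-pencil-laminar-charge` and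
`taubes-circle-cancellation` (`Cruxes/Target/Ideas/*.md`, sketch `Cruxes/Target/SketchIdeator2.lean`:
`ClosedTamingKillsWitnesses`, `WeakTame`, `target_of_weakTame`), now PROVED in the tree with the
sketch's predicates `JSq / JSmooth / JStdOn` unfolded:

* `closedTamingKillsWitnesses` — if `J` on `M ∖ p` is standard on the punctured `ε'`-chart-ball
  and SOME smooth CLOSED `2`-form `sf` tames `J` everywhere (no standardness of `sf`, nothing
  prescribed at the end), then `J` has no taming witness at any radius `0 < ε < ε'`.  The tree
  had the exact-form case (`closedExactTamingKillsWitnesses`, `sf = dγ`); the closed case is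
  reduced to it near the puncture by the de Rham input `H²_dR(B⁴ ∖ 0) = 0`
  (`helper_poincareLemma_two_puncturedChartBall`, Mayer–Vietoris over the tree's local de Rham
  complex) transported to the punctured manifold (`helper_primitiveOnPuncturedBall`): `sf = dγ`
  on the punctured `ε`-ball, and then (W2) kills `sf - dγ`, (W2) kills `d(φγ)`, the collar lemma
  kills `d((1-φ)γ)` (`helper_closedTamingKillsWitnessesOfPrimitive`), contradicting (W1).
* `target_of_weakTame` — hence route SullivanDual's `Target` follows from **WeakTame**: every
  punctured homotopy `4`-sphere carries a smooth `J`, `J² = -1`, standard near the puncture,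
  tamed by some smooth closed `2`-form; conversely `weakTame_of_target` / `target_iff_weakTame`
  modulo the route's named-fact debt `GromovChartForm` (the door is lossless).

References: D. Sullivan, Invent. Math. 36 (1976), Thm. I.7 [Sullivan1976]; R. Bott, L. W. Tu,
*Differential Forms in Algebraic Topology* (1982), Prop. 2.3 [BottTu1982Forms].
-/

noncomputable section

-- the registered namespace `Summit.SmoothPoincare4.SmoothPoincare4.Theorems` repeats a component
set_option linter.dupNamespace false

open scoped Manifold ContDiff Topology InnerProductSpace
open Set Filter Metric
open Literature.Geometry.Kaehler Literature.Geometry.Symplectic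

namespace Summit.SmoothPoincare4.SmoothPoincare4.Theorems

namespace SullivanDual

/-- **Closed taming kills witnesses.** Let `M` be a smooth Hausdorff second-countable
`4`-manifold (in `Type`, the universe of the model space, as forced by the tree's star-shaped
Poincaré lemma), `p ∈ M`, `J` a field of endomorphisms of `T(M ∖ p)` which is STANDARD on the
punctured `ε'`-chart-ball at `p` (`⟪A (J v), b⟫ = ω₀(A v, b)`, `A = Dι(e x − e p) ∘ De_x`, with
`closedBall (e p) ε' ⊆ e.target`), and suppose some smooth CLOSED `2`-form `sf` on `M ∖ p`
satisfies `sf(v, Jv) > 0` for all `v ≠ 0`. Then `J` has no taming witness at any radius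
`0 < ε < ε'`. Proof: `H²_dR` of the punctured chart-ball vanishes, so `sf = dγ` on the punctured
`ε`-ball for a smooth `1`-form `γ` on `M ∖ p`; conclude by
`helper_closedTamingKillsWitnessesOfPrimitive` (Sullivan's "a transversal closed form excludes
structure cycles", relative form). [cite: Sullivan1976, Thm. I.7] -/
theorem closedTamingKillsWitnesses
    {M : Type} [TopologicalSpace M] [T2Space M] [SecondCountableTopology M]
    [ChartedSpace (EuclideanSpace ℝ (Fin 4)) M] [IsManifold (𝓡 4) ∞ M] (p : M)
    (J : ∀ x : punctured p, TangentSpace (𝓡 4) x →L[ℝ] TangentSpace (𝓡 4) x) {ε ε' : ℝ}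
    (hε : 0 < ε) (hεε' : ε < ε')
    (hball : Metric.closedBall (extChartAt (𝓡 4) p p) ε' ⊆ (extChartAt (𝓡 4) p).target)
    (hstd : ∀ x : punctured p, InPuncturedChartBall p ε' x →
        ∀ (v : TangentSpace (𝓡 4) x) (b : EuclideanSpace ℝ (Fin 4)),
        inner ℝ (fderiv ℝ inversion (extChartAt (𝓡 4) p x.1 - extChartAt (𝓡 4) p p)
          (mfderiv (𝓡 4) 𝓘(ℝ, EuclideanSpace ℝ (Fin 4))
            (fun z : punctured p => extChartAt (𝓡 4) p z.1) x (J x v))) b =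
        stdSymplecticForm (fderiv ℝ inversion (extChartAt (𝓡 4) p x.1 - extChartAt (𝓡 4) p p)
          (mfderiv (𝓡 4) 𝓘(ℝ, EuclideanSpace ℝ (Fin 4))
            (fun z : punctured p => extChartAt (𝓡 4) p z.1) x v)) b)
    {sf : MForm (𝓡 4) (punctured p) ℝ 2} (hsf : IsSmoothForm sf) (hsfc : IsClosedForm sf)
    (htame : ∀ (x : punctured p) (v : TangentSpace (𝓡 4) x), v ≠ 0 → 0 < sf x ![v, J x v]) :
    NoWitness p ε J := by
  have hball' : Metric.ball (extChartAt (𝓡 4) p p) ε' ⊆ (extChartAt (𝓡 4) p).target :=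
    Metric.ball_subset_closedBall.trans hball
  obtain ⟨γ, hγ, hγsf⟩ := helper_primitiveOnPuncturedBall p hε hεε' hball'
    (fun hW => helper_poincareLemma_two_puncturedChartBall p (hε.trans hεε') hball' hW) sf hsf hsfc
  exact helper_closedTamingKillsWitnessesOfPrimitive p J hε hεε' hball hstd hsf hsfc htame hγ hγsf

/-- **`Target ⇐ WeakTame`** (the transferred form of the crux in line `Sketch`, ideator 2; entry
door of the crux ideas `crofton-pencil-laminar-charge` and `taubes-circle-cancellation`). If
every punctured homotopy `4`-sphere `Σ ∖ p` carries a smooth almost complex structure `J`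
(`J² = -1`, smooth in tangent coordinates), standard on a punctured chart-ball at `p` whose
closure lies in the chart target, which is tamed EVERYWHERE by SOME smooth closed `2`-form — no
standardness of the form, nothing prescribed at the end — then route SullivanDual's `Target`
holds: with that `J` and `ε₁ := ε'/2`, `closedTamingKillsWitnesses` excludes witnesses at every
radius `ε ≤ ε₁ < ε'`. [cite: Sullivan1976, Thm. I.7] -/
theorem target_of_weakTame
    (hW : ∀ (S : Literature.Topology.FourManifolds.HomotopySphere 4) (p : S.carrier),
      ∃ (J : ∀ x : punctured p, TangentSpace (𝓡 4) x →L[ℝ] TangentSpace (𝓡 4) x) (ε' : ℝ),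
        0 < ε' ∧ Metric.closedBall (extChartAt (𝓡 4) p p) ε' ⊆ (extChartAt (𝓡 4) p).target ∧
        (∀ (x : punctured p) (v : TangentSpace (𝓡 4) x), J x (J x v) = -v) ∧
        (∀ x₀ : punctured p, ContMDiffAt (𝓡 4)
          𝓘(ℝ, EuclideanSpace ℝ (Fin 4) →L[ℝ] EuclideanSpace ℝ (Fin 4)) ∞
          (inTangentCoordinates (𝓡 4) (𝓡 4) (id : punctured p → punctured p) id
            (fun x => J x) x₀) x₀) ∧
        (∀ x : punctured p, InPuncturedChartBall p ε' x →
          ∀ (v : TangentSpace (𝓡 4) x) (b : EuclideanSpace ℝ (Fin 4)),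
          inner ℝ (fderiv ℝ inversion (extChartAt (𝓡 4) p x.1 - extChartAt (𝓡 4) p p)
            (mfderiv (𝓡 4) 𝓘(ℝ, EuclideanSpace ℝ (Fin 4))
              (fun z : punctured p => extChartAt (𝓡 4) p z.1) x (J x v))) b =
          stdSymplecticForm (fderiv ℝ inversion (extChartAt (𝓡 4) p x.1 - extChartAt (𝓡 4) p p)
            (mfderiv (𝓡 4) 𝓘(ℝ, EuclideanSpace ℝ (Fin 4))
              (fun z : punctured p => extChartAt (𝓡 4) p z.1) x v)) b) ∧
        ∃ sf : MForm (𝓡 4) (punctured p) ℝ 2, IsSmoothForm sf ∧ IsClosedForm sf ∧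
          ∀ (x : punctured p) (v : TangentSpace (𝓡 4) x), v ≠ 0 → 0 < sf x ![v, J x v]) :
    Summit.SmoothPoincare4.SmoothPoincare4.Theses.SullivanDual.Target := by
  intro S p
  obtain ⟨J, ε', hε', hball, hJ2, hJs, hstd, sf, hsf, hsfc, htame⟩ := hW S p
  refine ⟨J, hJ2, hJs, ε' / 2, by positivity, fun ε hε hεle T hT => ?_⟩
  have hlt : ε < ε' := lt_of_le_of_lt hεle (by linarith)
  exact closedTamingKillsWitnesses p J hε hlt hball hstd hsf hsfc htame T hT

/-- **The door is lossless: `Target ⇒ WeakTame` modulo the route's one named-fact debt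
`GromovChartForm`** (item 11129 ⇐ Gromov's recognition of `ℝ⁴`, item 11009): by the landed
`weakTameExact_of_target` (over `RelativeSullivanDuality_proof`, 7827, and the chart form) the
taming form may even be taken EXACT, `sf = dγ`, which is closed (`d ∘ d = 0`). [folklore] -/
theorem weakTame_of_target
    (hG : Summit.SmoothPoincare4.SmoothPoincare4.Theses.SullivanDual.GromovChartForm)
    (hT : Summit.SmoothPoincare4.SmoothPoincare4.Theses.SullivanDual.Target)
    (S : Literature.Topology.FourManifolds.HomotopySphere 4) (p : S.carrier) :
      ∃ (J : ∀ x : punctured p, TangentSpace (𝓡 4) x →L[ℝ] TangentSpace (𝓡 4) x) (ε' : ℝ),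
        0 < ε' ∧ Metric.closedBall (extChartAt (𝓡 4) p p) ε' ⊆ (extChartAt (𝓡 4) p).target ∧
        (∀ (x : punctured p) (v : TangentSpace (𝓡 4) x), J x (J x v) = -v) ∧
        (∀ x₀ : punctured p, ContMDiffAt (𝓡 4)
          𝓘(ℝ, EuclideanSpace ℝ (Fin 4) →L[ℝ] EuclideanSpace ℝ (Fin 4)) ∞
          (inTangentCoordinates (𝓡 4) (𝓡 4) (id : punctured p → punctured p) id
            (fun x => J x) x₀) x₀) ∧
        (∀ x : punctured p, InPuncturedChartBall p ε' x →
          ∀ (v : TangentSpace (𝓡 4) x) (b : EuclideanSpace ℝ (Fin 4)),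
          inner ℝ (fderiv ℝ inversion (extChartAt (𝓡 4) p x.1 - extChartAt (𝓡 4) p p)
            (mfderiv (𝓡 4) 𝓘(ℝ, EuclideanSpace ℝ (Fin 4))
              (fun z : punctured p => extChartAt (𝓡 4) p z.1) x (J x v))) b =
          stdSymplecticForm (fderiv ℝ inversion (extChartAt (𝓡 4) p x.1 - extChartAt (𝓡 4) p p)
            (mfderiv (𝓡 4) 𝓘(ℝ, EuclideanSpace ℝ (Fin 4))
              (fun z : punctured p => extChartAt (𝓡 4) p z.1) x v)) b) ∧
        ∃ sf : MForm (𝓡 4) (punctured p) ℝ 2, IsSmoothForm sf ∧ IsClosedForm sf ∧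
          ∀ (x : punctured p) (v : TangentSpace (𝓡 4) x), v ≠ 0 → 0 < sf x ![v, J x v] := by
  have hd : inChart_mextDeriv (𝓡 4) (punctured p) ℝ := inChart_mextDeriv_holds _ _ _
  obtain ⟨J, ε', hε', hball, hJ2, hJs, hstd, γ, hγ, htame⟩ :=
    weakTameExact_of_target hT RelativeSullivanDuality_proof hG S p
  exact ⟨J, ε', hε', hball, hJ2, hJs, hstd, mextDeriv γ, isSmoothForm_mextDeriv hd hγ,
    mextDeriv_mextDeriv hd hγ, htame⟩

/-- **`Target ↔ WeakTame` given `GromovChartForm`**: the transferred form of the crux in line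
`Sketch` is exactly as strong as the crux (and as the summit, by `target_iff_smoothPoincare4`).
[folklore] -/
theorem target_iff_weakTame
    (hG : Summit.SmoothPoincare4.SmoothPoincare4.Theses.SullivanDual.GromovChartForm) :
    Summit.SmoothPoincare4.SmoothPoincare4.Theses.SullivanDual.Target ↔
      ∀ (S : Literature.Topology.FourManifolds.HomotopySphere 4) (p : S.carrier),
      ∃ (J : ∀ x : punctured p, TangentSpace (𝓡 4) x →L[ℝ] TangentSpace (𝓡 4) x) (ε' : ℝ),
        0 < ε' ∧ Metric.closedBall (extChartAt (𝓡 4) p p) ε' ⊆ (extChartAt (𝓡 4) p).target ∧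
        (∀ (x : punctured p) (v : TangentSpace (𝓡 4) x), J x (J x v) = -v) ∧
        (∀ x₀ : punctured p, ContMDiffAt (𝓡 4)
          𝓘(ℝ, EuclideanSpace ℝ (Fin 4) →L[ℝ] EuclideanSpace ℝ (Fin 4)) ∞
          (inTangentCoordinates (𝓡 4) (𝓡 4) (id : punctured p → punctured p) id
            (fun x => J x) x₀) x₀) ∧
        (∀ x : punctured p, InPuncturedChartBall p ε' x →
          ∀ (v : TangentSpace (𝓡 4) x) (b : EuclideanSpace ℝ (Fin 4)),
          inner ℝ (fderiv ℝ inversion (extChartAt (𝓡 4) p x.1 - extChartAt (𝓡 4) p p)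
            (mfderiv (𝓡 4) 𝓘(ℝ, EuclideanSpace ℝ (Fin 4))
              (fun z : punctured p => extChartAt (𝓡 4) p z.1) x (J x v))) b =
          stdSymplecticForm (fderiv ℝ inversion (extChartAt (𝓡 4) p x.1 - extChartAt (𝓡 4) p p)
            (mfderiv (𝓡 4) 𝓘(ℝ, EuclideanSpace ℝ (Fin 4))
              (fun z : punctured p => extChartAt (𝓡 4) p z.1) x v)) b) ∧
        ∃ sf : MForm (𝓡 4) (punctured p) ℝ 2, IsSmoothForm sf ∧ IsClosedForm sf ∧
          ∀ (x : punctured p) (v : TangentSpace (𝓡 4) x), v ≠ 0 → 0 < sf x ![v, J x v] :=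
  ⟨fun hT S p => weakTame_of_target hG hT S p, target_of_weakTame⟩

end SullivanDual

end Summit.SmoothPoincare4.SmoothPoincare4.Theorems

end
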